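import Mathlib.Analysis.SpecialFunctions.SmoothTransition
import Mathlib.MeasureTheory.Integral.Prod
import Mathlib.MeasureTheory.Integral.IntervalIntegral.FundThmCalculus
import Mathlib.MeasureTheory.Function.LocallyIntegrable
import Summits.AtomisticToContinuum.HydrodynamicLimit.Theorems.InformationPercolationEngineChaosClosesEulerShellWeights
import Summits.AtomisticToContinuum.HydrodynamicLimit.Theorems.InformationPercolationEngineChaosClosesEulerReductionSmooth
import HarnessLib

/-!
# BF18 shell for functions (crux `ChaosClosesEuler`, stmt-AtomisticToContinuum-15141, line `Sketch`,
# stub `stub_bf18Shell`) — helper: weighted-in-time bookkeeping (`stub_bf18ShellTime`)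

WHAT. The deterministic BF18 relative-energy shell of the line receives its particle inputs only tested
against the smooth decreasing time cut-off `cut(s) = ζ((τ₀ + Δ − s)/Δ)` (`ζ = Real.smoothTransition`;
`cut = 1` for `s ≤ τ₀`, `cut = 0` for `s ≥ τ₀ + Δ`), i.e. averaged in time against the weight
`w = −cut' ≥ 0`, a probability density on the window `[τ₀, τ₀ + Δ] ⊆ [0, t]`. Each quantity summed by the
shell is known as `X(τ) = X0 + ∫₀^τ G + e(τ)` with `|e| ≤ δ` on `[0, t]`, and its `w`-average is
`∫₀ᵗ w X = X0 ∫₀ᵗ w + ∫₀ᵗ cut · G + ∫₀ᵗ w e = X0 + ∫₀ᵗ cut · G + O(δ)` by `∫₀ᵗ w = cut(0) − cut(t) = 1`,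
Fubini on the triangle `{0 ≤ s ≤ τ ≤ t}` and `∫ₛᵗ w = cut(s) − cut(t) = cut(s)`. Contents: §1 the bookkeeping
for an abstract `C¹` cut-off `c` with continuous derivative `c'` and weight `−c'` (FTC, the weighted Fubini
identity `integral_neg_mul_setIntegral`, the average of `X0 + ∫₀^τ G + δ`, averaging bounds for a nonnegative
weight of unit mass, the abstract two-sided statement); §2 (T1) the concrete weight `w = −cut'`: `w ≥ 0`,
`w = 0` off `(τ₀, τ₀ + Δ)`, continuity, a uniform bound, `∫_{[a,b]} w = cut a − cut b`, `∫_{[0,t]} w = 1`,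
integrability of `w X`, `cut X`; §3 (T2) `∫₀ᵗ w(τ) ∫₀^τ G dτ = ∫₀ᵗ cut · G`, (T3) one- and two-sided averaging
bounds, (T5) the cut-feed `∫₀ᵗ cut · R ≤ C ∫₀^{τ₀+Δ} F` of the windowed Grönwall step, and (T4) the registered
statement `stub_bf18ShellTime`. One-sided bounds against `X0 + ∫₀^τ G ± δ` follow from
`integral_weight_mul_affine`, `integrableOn_weight_mul_affine` and `setIntegral_mono_on`.

WHY. The inputs of the shell are tested against `θ̃(s, x) cut(s)` only (fixed tests, in-probability
antecedents), so every balance law arrives `w`-averaged in time; this file converts the averaged laws back into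
the form `X0 + ∫ cut · G + O(δ)` consumed by the windowed Grönwall lemma `window_gronwall`.

No named fact is invoked.
-/

noncomputable section

namespace Summit.AtomisticToContinuum.HydrodynamicLimit.Theorems.ChaosClosesEulerShellTime

open Set MeasureTheory
open Summit.AtomisticToContinuum.HydrodynamicLimit.Theorems.ChaosClosesEulerShell (neg_deriv_cut_eq hasDerivAt_cut_s)
open Summit.AtomisticToContinuum.HydrodynamicLimit.Theorems.ChaosClosesEulerReduction
  (contDiff_cut cut_mem cut_eq_zero cut_eq_one exists_bound_deriv_smoothTransition)
open Literature.Analysis.Calculus (deriv_smoothTransition_of_nonpos deriv_smoothTransition_of_one_le)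

/-! ## §1 Abstract bookkeeping: a `C¹` cut-off `c` with continuous derivative `c'`, weight `−c'` -/
section Abstract
variable {c c' : ℝ → ℝ}

/-- FTC for the weight `−c'`: `∫_{[a,b]} (−c') = c(a) − c(b)` (`a ≤ b`, `c'` continuous). [folklore] -/
theorem integral_Icc_neg_eq_sub (hc : ∀ x, HasDerivAt c (c' x) x) (hc' : Continuous c') {a b : ℝ}
    (hab : a ≤ b) : ∫ τ in Icc a b, -c' τ = c a - c b := by
  rw [integral_Icc_eq_integral_Ioc, ← intervalIntegral.integral_of_le hab, intervalIntegral.integral_neg,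
    intervalIntegral.integral_eq_sub_of_hasDerivAt (fun x _ => hc x) (hc'.intervalIntegrable _ _)]
  ring

/-- Unit mass: `∫_{[0,t]} (−c') = 1` when `c(0) = 1`, `c(t) = 0`, `0 ≤ t`. [folklore] -/
theorem integral_Icc_neg_eq_one (hc : ∀ x, HasDerivAt c (c' x) x) (hc' : Continuous c') {t : ℝ}
    (h0t : 0 ≤ t) (hc0 : c 0 = 1) (hct : c t = 0) : ∫ τ in Icc 0 t, -c' τ = 1 := by
  rw [integral_Icc_neg_eq_sub hc hc' h0t, hc0, hct, sub_zero]

/-- A continuous weight times an integrable function is integrable on a compact interval. [folklore] -/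
theorem integrableOn_neg_mul (hc' : Continuous c') {X : ℝ → ℝ} {a b : ℝ} (hX : IntegrableOn X (Icc a b)) :
    IntegrableOn (fun τ => -c' τ * X τ) (Icc a b) :=
  IntegrableOn.continuousOn_mul hc'.neg.continuousOn hX isCompact_Icc

/-- **Weighted Fubini on the triangle `{0 ≤ s ≤ τ ≤ t}`.** For `G` integrable on `[0, t]` and a `C¹` cut-off
`c` with continuous derivative `c'`: `τ ↦ −c'(τ) ∫_{[0,τ]} G` is integrable on `[0, t]` and
`∫_{τ∈[0,t]} (−c'(τ)) ∫_{s∈[0,τ]} G(s) = ∫_{s∈[0,t]} (c(s) − c(t)) G(s)` (`∫_{[s,t]} (−c') = c(s) − c(t)`). [folklore] -/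
theorem integral_neg_mul_setIntegral (hc : ∀ x, HasDerivAt c (c' x) x) (hc' : Continuous c')
    {G : ℝ → ℝ} {t : ℝ} (hG : IntegrableOn G (Icc 0 t)) :
    IntegrableOn (fun τ => -c' τ * ∫ s in Icc 0 τ, G s) (Icc 0 t) ∧
    ∫ τ in Icc 0 t, -c' τ * ∫ s in Icc 0 τ, G s = ∫ s in Icc 0 t, (c s - c t) * G s := by
  rcases lt_or_ge t 0 with ht | _
  · rw [Icc_eq_empty_of_lt ht]
    exact ⟨integrableOn_empty, by simp⟩
  obtain ⟨K, hK⟩ :=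
    (isCompact_Icc : IsCompact (Icc (0 : ℝ) t)).exists_bound_of_continuousOn hc'.continuousOn
  set T : Set (ℝ × ℝ) := {p | p.2 ≤ p.1} with hT_def
  have hT : MeasurableSet T := measurableSet_le measurable_snd measurable_fst
  obtain ⟨f, hf⟩ : ∃ f : ℝ × ℝ → ℝ, f = fun p => -c' p.1 * T.indicator (fun q => G q.2) p := ⟨_, rfl⟩
  -- measurability and integrability on the square `[0,t]²`
  have hfm : AEStronglyMeasurable f
      ((volume.restrict (Icc (0 : ℝ) t)).prod (volume.restrict (Icc (0 : ℝ) t))) := by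
    rw [hf]
    exact (hc'.neg.comp continuous_fst).aestronglyMeasurable.mul
      ((hG.aestronglyMeasurable.comp_snd).indicator hT)
  have hfi : Integrable f ((volume.restrict (Icc (0 : ℝ) t)).prod (volume.restrict (Icc (0 : ℝ) t))) := by
    refine Integrable.mono' ((hG.norm.const_mul K).comp_snd (volume.restrict (Icc (0 : ℝ) t))) hfm ?_
    rw [(Measure.prod_restrict _ _ : (volume.restrict (Icc (0 : ℝ) t)).prod (volume.restrict (Icc (0 : ℝ) t))
      = (volume.prod volume).restrict (Icc 0 t ×ˢ Icc 0 t)),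
      ae_restrict_iff' (measurableSet_Icc.prod measurableSet_Icc)]
    refine ae_of_all _ fun p hp => ?_
    rw [hf]; dsimp only; rw [norm_mul, norm_neg]
    refine mul_le_mul (hK p.1 hp.1) ?_ (norm_nonneg _) ((norm_nonneg _).trans (hK p.1 hp.1))
    by_cases hpT : p ∈ T
    · rw [indicator_of_mem hpT]
    · rw [indicator_of_notMem hpT, norm_zero]; exact norm_nonneg _
  -- the two iterated integrals, slice by slice (`T`-slices are `Iic τ` and `Ici s`)
  have hleft : ∀ τ ∈ Icc (0 : ℝ) t,
      ∫ s, f (τ, s) ∂(volume.restrict (Icc (0 : ℝ) t)) = -c' τ * ∫ s in Icc 0 τ, G s := by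
    intro τ hτ
    have hind : (fun s => f (τ, s)) = fun s => -c' τ * (Iic τ).indicator G s := by
      funext s; rw [hf]; dsimp only; congr 1
    have hset : Iic τ ∩ Icc 0 t = Icc 0 τ := by
      ext s; simp only [mem_inter_iff, mem_Iic, mem_Icc]
      exact ⟨fun h => ⟨h.2.1, h.1⟩, fun h => ⟨h.2, h.1, h.2.trans hτ.2⟩⟩
    rw [hind, integral_const_mul, integral_indicator measurableSet_Iic,
      Measure.restrict_restrict measurableSet_Iic, hset]
  have hright : ∀ s ∈ Icc (0 : ℝ) t,
      ∫ τ, f (τ, s) ∂(volume.restrict (Icc (0 : ℝ) t)) = (c s - c t) * G s := by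
    intro s hs
    have hind : (fun τ => f (τ, s)) = fun τ => (Ici s).indicator (fun τ => -c' τ * G s) τ := by
      funext τ; rw [hf]; dsimp only
      by_cases hτ : s ≤ τ
      · rw [indicator_of_mem (show (τ, s) ∈ T from hτ), indicator_of_mem (mem_Ici.2 hτ)]
      · rw [indicator_of_notMem (show (τ, s) ∉ T from hτ), indicator_of_notMem (fun h => hτ (mem_Ici.1 h)),
          mul_zero]
    have hset : Ici s ∩ Icc 0 t = Icc s t := by
      ext τ; simp only [mem_inter_iff, mem_Ici, mem_Icc]
      exact ⟨fun h => ⟨h.1, h.2.2⟩, fun h => ⟨h.1, hs.1.trans h.1, h.2⟩⟩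
    rw [hind, integral_indicator measurableSet_Ici, Measure.restrict_restrict measurableSet_Ici, hset,
      integral_mul_const, integral_Icc_neg_eq_sub hc hc' hs.2]
  refine ⟨IntegrableOn.congr_fun hfi.integral_prod_left hleft measurableSet_Icc, ?_⟩
  calc ∫ τ in Icc 0 t, -c' τ * ∫ s in Icc 0 τ, G s
      = ∫ τ, ∫ s, f (τ, s) ∂(volume.restrict (Icc (0 : ℝ) t)) ∂(volume.restrict (Icc (0 : ℝ) t)) :=
        (setIntegral_congr_fun measurableSet_Icc hleft).symm
    _ = ∫ s, ∫ τ, f (τ, s) ∂(volume.restrict (Icc (0 : ℝ) t)) ∂(volume.restrict (Icc (0 : ℝ) t)) :=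
        integral_integral_swap (f := fun τ s => f (τ, s)) hfi
    _ = ∫ s in Icc 0 t, (c s - c t) * G s := setIntegral_congr_fun measurableSet_Icc hright

/-- Integrability of `−c'(τ) (X0 + ∫_{[0,τ]} G + δ)` on `[0, t]`. [folklore] -/
theorem integrableOn_neg_mul_affine (hc : ∀ x, HasDerivAt c (c' x) x) (hc' : Continuous c')
    {G : ℝ → ℝ} {t : ℝ} (hG : IntegrableOn G (Icc 0 t)) (X0 δ : ℝ) :
    IntegrableOn (fun τ => -c' τ * (X0 + (∫ s in Icc 0 τ, G s) + δ)) (Icc 0 t) := by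
  have hw : IntegrableOn (fun τ => -c' τ) (Icc 0 t) := hc'.neg.integrableOn_Icc
  have h : IntegrableOn (fun τ => -c' τ * X0 + -c' τ * (∫ s in Icc 0 τ, G s) + -c' τ * δ) (Icc 0 t) :=
    ((hw.mul_const X0).add (integral_neg_mul_setIntegral hc hc' hG).1).add (hw.mul_const δ)
  exact h.congr_fun (fun τ _ => by ring) measurableSet_Icc

/-- **The `−c'`-average of `X0 + ∫_{[0,τ]} G + δ`** is `X0 + ∫_{[0,t]} c · G + δ` (`c(0) = 1`, `c(t) = 0`). [folklore] -/
theorem integral_neg_mul_affine (hc : ∀ x, HasDerivAt c (c' x) x) (hc' : Continuous c')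
    {G : ℝ → ℝ} {t : ℝ} (hG : IntegrableOn G (Icc 0 t)) (h0t : 0 ≤ t) (hc0 : c 0 = 1) (hct : c t = 0)
    (X0 δ : ℝ) :
    ∫ τ in Icc 0 t, -c' τ * (X0 + (∫ s in Icc 0 τ, G s) + δ) = X0 + (∫ s in Icc 0 t, c s * G s) + δ := by
  have hw : IntegrableOn (fun τ => -c' τ) (Icc 0 t) := hc'.neg.integrableOn_Icc
  obtain ⟨hP, hPeq⟩ := integral_neg_mul_setIntegral hc hc' hG
  have h1 : IntegrableOn (fun τ => -c' τ * X0 + -c' τ * ∫ s in Icc 0 τ, G s) (Icc 0 t) :=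
    (hw.mul_const X0).add hP
  have hfun : EqOn (fun τ => -c' τ * (X0 + (∫ s in Icc 0 τ, G s) + δ))
      (fun τ => -c' τ * X0 + -c' τ * (∫ s in Icc 0 τ, G s) + -c' τ * δ) (Icc 0 t) := fun τ _ => by ring
  rw [setIntegral_congr_fun measurableSet_Icc hfun, integral_add h1 (hw.mul_const δ),
    integral_add (hw.mul_const X0) hP, hPeq, integral_mul_const, integral_mul_const,
    integral_Icc_neg_eq_one hc hc' h0t hc0 hct, one_mul, one_mul, hct]
  simp only [sub_zero]

/-- **Two-sided averaging bound.** For a nonnegative weight `w` of unit mass on a measurable `S` and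
`|e| ≤ δ` on `S`: `|∫_S w e| ≤ δ`. [folklore] -/
theorem abs_setIntegral_mul_le {w e : ℝ → ℝ} {S : Set ℝ} {δ : ℝ} (hS : MeasurableSet S)
    (hw : IntegrableOn w S) (hw0 : ∀ τ ∈ S, 0 ≤ w τ) (hw1 : ∫ τ in S, w τ = 1) (hδ : ∀ τ ∈ S, |e τ| ≤ δ) :
    |∫ τ in S, w τ * e τ| ≤ δ := by
  have hb : ∀ᵐ τ ∂(volume.restrict S), ‖w τ * e τ‖ ≤ w τ * δ := by
    rw [ae_restrict_iff' hS]
    refine ae_of_all _ fun τ hτ => ?_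
    rw [Real.norm_eq_abs, abs_mul, abs_of_nonneg (hw0 τ hτ)]
    exact mul_le_mul_of_nonneg_left (hδ τ hτ) (hw0 τ hτ)
  have h := norm_integral_le_of_norm_le (hw.mul_const δ) hb
  rw [Real.norm_eq_abs, integral_mul_const, hw1, one_mul] at h
  exact h

/-- **Upper averaging bound.** For a nonnegative weight `w` of unit mass on `S`, `w X` integrable and `X ≤ B`
on `S`: `∫_S w X ≤ B`. [folklore] -/
theorem setIntegral_mul_le_of_le {w X : ℝ → ℝ} {S : Set ℝ} {B : ℝ} (hS : MeasurableSet S)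
    (hw : IntegrableOn w S) (hw0 : ∀ τ ∈ S, 0 ≤ w τ) (hw1 : ∫ τ in S, w τ = 1)
    (hwX : IntegrableOn (fun τ => w τ * X τ) S) (hb : ∀ τ ∈ S, X τ ≤ B) : ∫ τ in S, w τ * X τ ≤ B := by
  calc ∫ τ in S, w τ * X τ ≤ ∫ τ in S, w τ * B :=
        setIntegral_mono_on hwX (hw.mul_const B) hS fun τ hτ => mul_le_mul_of_nonneg_left (hb τ hτ) (hw0 τ hτ)
    _ = B := by rw [integral_mul_const, hw1, one_mul]

/-- **Lower averaging bound.** For a nonnegative weight `w` of unit mass on `S`, `w X` integrable and `B ≤ X`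
on `S`: `B ≤ ∫_S w X`. [folklore] -/
theorem le_setIntegral_mul_of_le {w X : ℝ → ℝ} {S : Set ℝ} {B : ℝ} (hS : MeasurableSet S)
    (hw : IntegrableOn w S) (hw0 : ∀ τ ∈ S, 0 ≤ w τ) (hw1 : ∫ τ in S, w τ = 1)
    (hwX : IntegrableOn (fun τ => w τ * X τ) S) (hb : ∀ τ ∈ S, B ≤ X τ) : B ≤ ∫ τ in S, w τ * X τ := by
  calc B = ∫ τ in S, w τ * B := by rw [integral_mul_const, hw1, one_mul]
    _ ≤ ∫ τ in S, w τ * X τ :=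
        setIntegral_mono_on (hw.mul_const B) hwX hS fun τ hτ => mul_le_mul_of_nonneg_left (hb τ hτ) (hw0 τ hτ)

/-- **Abstract two-sided bookkeeping.** With `−c' ≥ 0`, `c(0) = 1`, `c(t) = 0`, `G, e` integrable and
`|e| ≤ δ` on `[0, t]`: `|∫_{[0,t]} (−c')(X0 + ∫_{[0,τ]} G + e) − (X0 + ∫_{[0,t]} c · G)| ≤ δ`. [folklore] -/
theorem abs_integral_neg_mul_affine_sub_le (hc : ∀ x, HasDerivAt c (c' x) x) (hc' : Continuous c')
    (hw0 : ∀ τ, 0 ≤ -c' τ) {G e : ℝ → ℝ} {t X0 δ : ℝ} (h0t : 0 ≤ t) (hc0 : c 0 = 1) (hct : c t = 0)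
    (hG : IntegrableOn G (Icc 0 t)) (he : IntegrableOn e (Icc 0 t)) (hδ : ∀ τ ∈ Icc 0 t, |e τ| ≤ δ) :
    |(∫ τ in Icc 0 t, -c' τ * (X0 + (∫ s in Icc 0 τ, G s) + e τ)) - (X0 + ∫ s in Icc 0 t, c s * G s)| ≤ δ := by
  have hA := integrableOn_neg_mul_affine hc hc' hG X0 0
  have hE : IntegrableOn (fun τ => -c' τ * e τ) (Icc 0 t) := integrableOn_neg_mul hc' he
  have hfun : EqOn (fun τ => -c' τ * (X0 + (∫ s in Icc 0 τ, G s) + e τ))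
      (fun τ => -c' τ * (X0 + (∫ s in Icc 0 τ, G s) + 0) + -c' τ * e τ) (Icc 0 t) := fun τ _ => by ring
  rw [setIntegral_congr_fun measurableSet_Icc hfun, integral_add hA hE,
    integral_neg_mul_affine hc hc' hG h0t hc0 hct X0 0, add_zero, add_sub_cancel_left]
  exact abs_setIntegral_mul_le measurableSet_Icc hc'.neg.integrableOn_Icc (fun τ _ => hw0 τ)
    (integral_Icc_neg_eq_one hc hc' h0t hc0 hct) hδ

end Abstract

/-! ## §2 (T1) The time cut-off `cut(s) = ζ((τ₀ + Δ − s)/Δ)` and its weight `w = −cut'` -/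
section Concrete
variable {τ₀ Δ t : ℝ}

/-- The cut-off has derivative `deriv cut` everywhere. [folklore] -/
theorem hasDerivAt_cut_deriv (τ₀ Δ x : ℝ) :
    HasDerivAt (fun s' => Real.smoothTransition ((τ₀ + Δ - s') / Δ))
      (deriv (fun s' => Real.smoothTransition ((τ₀ + Δ - s') / Δ)) x) x :=
  (hasDerivAt_cut_s τ₀ Δ x).differentiableAt.hasDerivAt

/-- The derivative of the cut-off is continuous (so the weight `w = −cut'` is continuous). [folklore] -/
theorem continuous_deriv_cut (τ₀ Δ : ℝ) :
    Continuous (deriv fun s' => Real.smoothTransition ((τ₀ + Δ - s') / Δ)) :=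
  (contDiff_cut τ₀ Δ (n := 1)).continuous_deriv le_rfl

/-- **The weight is nonnegative** (`Δ > 0`): `w(τ) = ζ'((τ₀+Δ−τ)/Δ)/Δ ≥ 0` (`ζ` is monotone). [folklore] -/
theorem weight_nonneg (hΔ : 0 < Δ) (τ₀ τ : ℝ) :
    0 ≤ -deriv (fun s' => Real.smoothTransition ((τ₀ + Δ - s') / Δ)) τ := by
  rw [neg_deriv_cut_eq]
  exact div_nonneg Real.smoothTransition.monotone.deriv_nonneg hΔ.le

/-- The weight vanishes before the window: `w(τ) = 0` for `τ ≤ τ₀` (`Δ > 0`). [folklore] -/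
theorem weight_eq_zero_of_le (hΔ : 0 < Δ) {τ : ℝ} (hτ : τ ≤ τ₀) :
    -deriv (fun s' => Real.smoothTransition ((τ₀ + Δ - s') / Δ)) τ = 0 := by
  rw [neg_deriv_cut_eq, deriv_smoothTransition_of_one_le, zero_div]
  rw [le_div_iff₀ hΔ]; linarith

/-- The weight vanishes after the window: `w(τ) = 0` for `τ₀ + Δ ≤ τ` (`Δ > 0`). [folklore] -/
theorem weight_eq_zero_of_ge (hΔ : 0 < Δ) {τ : ℝ} (hτ : τ₀ + Δ ≤ τ) :
    -deriv (fun s' => Real.smoothTransition ((τ₀ + Δ - s') / Δ)) τ = 0 := by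
  rw [neg_deriv_cut_eq, deriv_smoothTransition_of_nonpos, zero_div]
  exact div_nonpos_of_nonpos_of_nonneg (by linarith) hΔ.le

/-- The weight vanishes off the open window `(τ₀, τ₀ + Δ)` (`Δ > 0`). [folklore] -/
theorem weight_eq_zero_of_not_mem_Ioo (hΔ : 0 < Δ) {τ : ℝ} (hτ : τ ∉ Ioo τ₀ (τ₀ + Δ)) :
    -deriv (fun s' => Real.smoothTransition ((τ₀ + Δ - s') / Δ)) τ = 0 := by
  rcases not_and_or.1 hτ with h | h
  · exact weight_eq_zero_of_le hΔ (not_lt.1 h)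
  · exact weight_eq_zero_of_ge hΔ (not_lt.1 h)

/-- **A uniform bound on the weight**: `|w| ≤ K` on `ℝ` for some `K ≥ 0`. [folklore] -/
theorem exists_abs_weight_le (τ₀ Δ : ℝ) :
    ∃ K : ℝ, 0 ≤ K ∧ ∀ τ, |(-deriv (fun s' => Real.smoothTransition ((τ₀ + Δ - s') / Δ)) τ)| ≤ K := by
  obtain ⟨C, hC0, hC, -⟩ := exists_bound_deriv_smoothTransition
  refine ⟨C / |Δ|, div_nonneg hC0 (abs_nonneg _), fun τ => ?_⟩
  rw [neg_deriv_cut_eq, abs_div]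
  exact div_le_div_of_nonneg_right (hC _) (abs_nonneg _)

/-- **FTC for the weight**: `∫_{[a,b]} w = cut(a) − cut(b)` for `a ≤ b`. [folklore] -/
theorem integral_weight_Icc {a b : ℝ} (hab : a ≤ b) (τ₀ Δ : ℝ) :
    ∫ τ in Icc a b, -deriv (fun s' => Real.smoothTransition ((τ₀ + Δ - s') / Δ)) τ =
      Real.smoothTransition ((τ₀ + Δ - a) / Δ) - Real.smoothTransition ((τ₀ + Δ - b) / Δ) :=
  integral_Icc_neg_eq_sub (hasDerivAt_cut_deriv τ₀ Δ) (continuous_deriv_cut τ₀ Δ) hab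

/-- **Unit mass**: `∫_{[0,t]} w = cut(0) − cut(t) = 1 − 0` when `0 ≤ τ₀`, `τ₀ + Δ ≤ t` (`Δ > 0`). [folklore] -/
theorem integral_weight_eq_one (hΔ : 0 < Δ) (hτ₀ : 0 ≤ τ₀) (ht : τ₀ + Δ ≤ t) :
    ∫ τ in Icc 0 t, -deriv (fun s' => Real.smoothTransition ((τ₀ + Δ - s') / Δ)) τ = 1 :=
  integral_Icc_neg_eq_one (hasDerivAt_cut_deriv τ₀ Δ) (continuous_deriv_cut τ₀ Δ) (by linarith)
    (cut_eq_one hΔ hτ₀) (cut_eq_zero hΔ ht)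

/-- The weight is integrable on every compact interval. [folklore] -/
theorem integrableOn_weight (τ₀ Δ a b : ℝ) :
    IntegrableOn (fun τ => -deriv (fun s' => Real.smoothTransition ((τ₀ + Δ - s') / Δ)) τ) (Icc a b) :=
  (continuous_deriv_cut τ₀ Δ).neg.integrableOn_Icc

/-- The weight times an integrable function is integrable on a compact interval. [folklore] -/
theorem integrableOn_weight_mul {X : ℝ → ℝ} {a b : ℝ} (hX : IntegrableOn X (Icc a b)) (τ₀ Δ : ℝ) :
    IntegrableOn (fun τ => -deriv (fun s' => Real.smoothTransition ((τ₀ + Δ - s') / Δ)) τ * X τ) (Icc a b) :=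
  integrableOn_neg_mul (continuous_deriv_cut τ₀ Δ) hX

/-- `cut` times an integrable function is integrable (`cut` is continuous with values in `[0, 1]`). [folklore] -/
theorem integrableOn_cut_mul {X : ℝ → ℝ} {S : Set ℝ} (hX : IntegrableOn X S) (τ₀ Δ : ℝ) :
    IntegrableOn (fun s => Real.smoothTransition ((τ₀ + Δ - s) / Δ) * X s) S :=
  Integrable.bdd_mul hX (contDiff_cut τ₀ Δ (n := 0)).continuous.aestronglyMeasurable
    (ae_of_all _ fun s => by
      rw [Real.norm_eq_abs, abs_of_nonneg (cut_mem τ₀ Δ s).1]; exact (cut_mem τ₀ Δ s).2)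

/-! ## §3 (T2) weighted Fubini, (T3) averaging bounds, (T5) cut-feed, (T4) the registered statement -/

/-- **(T2) weighted Fubini, general form**: for `G` integrable on `[0, t]`, `τ ↦ w(τ) ∫_{[0,τ]} G` is
integrable on `[0, t]` and `∫_{τ∈[0,t]} w(τ) ∫_{s∈[0,τ]} G(s) = ∫_{s∈[0,t]} (cut(s) − cut(t)) G(s)`. [folklore] -/
theorem integral_weight_mul_setIntegral {G : ℝ → ℝ} (hG : IntegrableOn G (Icc 0 t)) (τ₀ Δ : ℝ) :
    IntegrableOn (fun τ => -deriv (fun s' => Real.smoothTransition ((τ₀ + Δ - s') / Δ)) τ *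
        ∫ s in Icc 0 τ, G s) (Icc 0 t) ∧
    ∫ τ in Icc 0 t, -deriv (fun s' => Real.smoothTransition ((τ₀ + Δ - s') / Δ)) τ * ∫ s in Icc 0 τ, G s =
      ∫ s in Icc 0 t, (Real.smoothTransition ((τ₀ + Δ - s) / Δ) -
        Real.smoothTransition ((τ₀ + Δ - t) / Δ)) * G s :=
  integral_neg_mul_setIntegral (hasDerivAt_cut_deriv τ₀ Δ) (continuous_deriv_cut τ₀ Δ) hG

/-- **(T2) weighted Fubini**: if `Δ > 0` and `τ₀ + Δ ≤ t` (so `cut(t) = 0`), then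
`∫_{τ∈[0,t]} w(τ) ∫_{s∈[0,τ]} G(s) = ∫_{s∈[0,t]} cut(s) G(s)`. [folklore] -/
theorem integral_weight_mul_setIntegral_eq (hΔ : 0 < Δ) (ht : τ₀ + Δ ≤ t) {G : ℝ → ℝ}
    (hG : IntegrableOn G (Icc 0 t)) :
    ∫ τ in Icc 0 t, -deriv (fun s' => Real.smoothTransition ((τ₀ + Δ - s') / Δ)) τ * ∫ s in Icc 0 τ, G s =
      ∫ s in Icc 0 t, Real.smoothTransition ((τ₀ + Δ - s) / Δ) * G s := by
  rw [(integral_weight_mul_setIntegral hG τ₀ Δ).2, cut_eq_zero hΔ ht]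
  simp only [sub_zero]

/-- Integrability of `w(τ) (X0 + ∫_{[0,τ]} G + δ)` on `[0, t]` for `G` integrable there. [folklore] -/
theorem integrableOn_weight_mul_affine {G : ℝ → ℝ} (hG : IntegrableOn G (Icc 0 t)) (τ₀ Δ X0 δ : ℝ) :
    IntegrableOn (fun τ => -deriv (fun s' => Real.smoothTransition ((τ₀ + Δ - s') / Δ)) τ *
      (X0 + (∫ s in Icc 0 τ, G s) + δ)) (Icc 0 t) :=
  integrableOn_neg_mul_affine (hasDerivAt_cut_deriv τ₀ Δ) (continuous_deriv_cut τ₀ Δ) hG X0 δ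

/-- The `w`-average of `X0 + ∫_{[0,τ]} G + δ` is `X0 + ∫_{[0,t]} cut · G + δ` (`0 ≤ τ₀`, `τ₀ + Δ ≤ t`). [folklore] -/
theorem integral_weight_mul_affine (hΔ : 0 < Δ) (hτ₀ : 0 ≤ τ₀) (ht : τ₀ + Δ ≤ t) {G : ℝ → ℝ}
    (hG : IntegrableOn G (Icc 0 t)) (X0 δ : ℝ) :
    ∫ τ in Icc 0 t, -deriv (fun s' => Real.smoothTransition ((τ₀ + Δ - s') / Δ)) τ *
        (X0 + (∫ s in Icc 0 τ, G s) + δ) =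
      X0 + (∫ s in Icc 0 t, Real.smoothTransition ((τ₀ + Δ - s) / Δ) * G s) + δ :=
  integral_neg_mul_affine (hasDerivAt_cut_deriv τ₀ Δ) (continuous_deriv_cut τ₀ Δ) hG (by linarith)
    (cut_eq_one hΔ hτ₀) (cut_eq_zero hΔ ht) X0 δ

/-- **(T3, two-sided)** `|∫_{[0,t]} w e| ≤ δ` when `|e| ≤ δ` on `[0, t]` (`Δ > 0`, `0 ≤ τ₀`, `τ₀ + Δ ≤ t`). [folklore] -/
theorem abs_integral_weight_mul_le (hΔ : 0 < Δ) (hτ₀ : 0 ≤ τ₀) (ht : τ₀ + Δ ≤ t) {e : ℝ → ℝ} {δ : ℝ}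
    (hδ : ∀ τ ∈ Icc 0 t, |e τ| ≤ δ) :
    |∫ τ in Icc 0 t, -deriv (fun s' => Real.smoothTransition ((τ₀ + Δ - s') / Δ)) τ * e τ| ≤ δ :=
  abs_setIntegral_mul_le measurableSet_Icc (integrableOn_weight τ₀ Δ 0 t) (fun τ _ => weight_nonneg hΔ τ₀ τ)
    (integral_weight_eq_one hΔ hτ₀ ht) hδ

/-- **(T3, upper)** `∫_{[0,t]} w X ≤ B` when `X ≤ B` on `[0, t]`, `X` integrable (`0 ≤ τ₀`, `τ₀ + Δ ≤ t`). [folklore] -/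
theorem integral_weight_mul_le_of_le (hΔ : 0 < Δ) (hτ₀ : 0 ≤ τ₀) (ht : τ₀ + Δ ≤ t) {X : ℝ → ℝ} {B : ℝ}
    (hX : IntegrableOn X (Icc 0 t)) (hb : ∀ τ ∈ Icc 0 t, X τ ≤ B) :
    ∫ τ in Icc 0 t, -deriv (fun s' => Real.smoothTransition ((τ₀ + Δ - s') / Δ)) τ * X τ ≤ B :=
  setIntegral_mul_le_of_le measurableSet_Icc (integrableOn_weight τ₀ Δ 0 t) (fun τ _ => weight_nonneg hΔ τ₀ τ)
    (integral_weight_eq_one hΔ hτ₀ ht) (integrableOn_weight_mul hX τ₀ Δ) hb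

/-- **(T3, lower)** `B ≤ ∫_{[0,t]} w X` when `B ≤ X` on `[0, t]`, `X` integrable (`0 ≤ τ₀`, `τ₀ + Δ ≤ t`). [folklore] -/
theorem le_integral_weight_mul_of_le (hΔ : 0 < Δ) (hτ₀ : 0 ≤ τ₀) (ht : τ₀ + Δ ≤ t) {X : ℝ → ℝ} {B : ℝ}
    (hX : IntegrableOn X (Icc 0 t)) (hb : ∀ τ ∈ Icc 0 t, B ≤ X τ) :
    B ≤ ∫ τ in Icc 0 t, -deriv (fun s' => Real.smoothTransition ((τ₀ + Δ - s') / Δ)) τ * X τ :=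
  le_setIntegral_mul_of_le measurableSet_Icc (integrableOn_weight τ₀ Δ 0 t) (fun τ _ => weight_nonneg hΔ τ₀ τ)
    (integral_weight_eq_one hΔ hτ₀ ht) (integrableOn_weight_mul hX τ₀ Δ) hb

/-- `∫_{[0,t]} cut · F ≤ ∫_{[0, τ₀+Δ]} F` for `F ≥ 0` integrable on `[0, t]` (`cut ≤ 1`, `cut = 0` on
`[τ₀ + Δ, t]`; `Δ > 0`, `τ₀ + Δ ≤ t`). [folklore] -/
theorem integral_cut_mul_le_integral (hΔ : 0 < Δ) (ht : τ₀ + Δ ≤ t) {F : ℝ → ℝ}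
    (hF : IntegrableOn F (Icc 0 t)) (hF0 : ∀ s ∈ Icc 0 t, 0 ≤ F s) :
    ∫ s in Icc 0 t, Real.smoothTransition ((τ₀ + Δ - s) / Δ) * F s ≤ ∫ s in Icc 0 (τ₀ + Δ), F s := by
  calc ∫ s in Icc 0 t, Real.smoothTransition ((τ₀ + Δ - s) / Δ) * F s
      ≤ ∫ s in Icc 0 t, (Icc 0 (τ₀ + Δ)).indicator F s := by
        refine setIntegral_mono_on (integrableOn_cut_mul hF τ₀ Δ) (hF.indicator measurableSet_Icc)
          measurableSet_Icc fun s hs => ?_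
        by_cases hsw : s ∈ Icc 0 (τ₀ + Δ)
        · rw [indicator_of_mem hsw]
          exact (mul_le_mul_of_nonneg_right (cut_mem τ₀ Δ s).2 (hF0 s hs)).trans_eq (one_mul _)
        · rw [indicator_of_notMem hsw, cut_eq_zero hΔ (le_of_not_ge fun h => hsw ⟨hs.1, h⟩), zero_mul]
    _ = ∫ s in Icc 0 (τ₀ + Δ), F s := by
        rw [integral_indicator measurableSet_Icc, Measure.restrict_restrict measurableSet_Icc,
          inter_eq_self_of_subset_left (Icc_subset_Icc_right ht)]

/-- **(T5) cut-feed.** For `F, R` integrable on `[0, t]`, `F ≥ 0` on `[0, t]`, `0 ≤ C` and `R ≤ C F` on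
`(0, t)`: `∫_{[0,t]} cut · R ≤ C ∫_{[0, τ₀+Δ]} F` (`Δ > 0`, `τ₀ + Δ ≤ t`; `{0, t}` is null). [folklore] -/
theorem integral_cut_mul_le (hΔ : 0 < Δ) (ht : τ₀ + Δ ≤ t) {F R : ℝ → ℝ} {C : ℝ}
    (hF : IntegrableOn F (Icc 0 t)) (hR : IntegrableOn R (Icc 0 t)) (hF0 : ∀ s ∈ Icc 0 t, 0 ≤ F s)
    (hC : 0 ≤ C) (hRF : ∀ s ∈ Ioo 0 t, R s ≤ C * F s) :
    ∫ s in Icc 0 t, Real.smoothTransition ((τ₀ + Δ - s) / Δ) * R s ≤ C * ∫ s in Icc 0 (τ₀ + Δ), F s := by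
  have h1 : IntegrableOn (fun s => Real.smoothTransition ((τ₀ + Δ - s) / Δ) * R s) (Ioo 0 t) :=
    (integrableOn_cut_mul hR τ₀ Δ).mono_set Ioo_subset_Icc_self
  have h2 : IntegrableOn (fun s => Real.smoothTransition ((τ₀ + Δ - s) / Δ) * (C * F s)) (Ioo 0 t) :=
    (integrableOn_cut_mul (hF.const_mul C) τ₀ Δ).mono_set Ioo_subset_Icc_self
  calc ∫ s in Icc 0 t, Real.smoothTransition ((τ₀ + Δ - s) / Δ) * R s
      = ∫ s in Ioo 0 t, Real.smoothTransition ((τ₀ + Δ - s) / Δ) * R s := integral_Icc_eq_integral_Ioo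
    _ ≤ ∫ s in Ioo 0 t, Real.smoothTransition ((τ₀ + Δ - s) / Δ) * (C * F s) :=
        setIntegral_mono_on h1 h2 measurableSet_Ioo fun s hs =>
          mul_le_mul_of_nonneg_left (hRF s hs) (cut_mem τ₀ Δ s).1
    _ = C * ∫ s in Icc 0 t, Real.smoothTransition ((τ₀ + Δ - s) / Δ) * F s := by
        rw [← integral_const_mul, integral_Icc_eq_integral_Ioo]
        exact setIntegral_congr_fun measurableSet_Ioo fun s _ => by ring
    _ ≤ C * ∫ s in Icc 0 (τ₀ + Δ), F s :=
        mul_le_mul_of_nonneg_left (integral_cut_mul_le_integral hΔ ht hF hF0) hC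

/-- REGISTERED SUB-GOAL `stub_bf18ShellTime` of the line `Sketch` (helper of `stub_bf18Shell`): **weighted-in-time
bookkeeping of the BF18 shell (T4).** If `X(τ) = X0 + ∫_{[0,τ]} G + e(τ)` with `G, e` integrable on `[0, t]`
and `|e| ≤ δ` there, then its average against the weight `w = −cut'` of a window `[τ₀, τ₀ + Δ] ⊆ [0, t]`
is `X0 + ∫_{[0,t]} cut · G` up to `δ`: `|∫_{[0,t]} w (X0 + ∫_{[0,τ]} G + e) dτ − (X0 + ∫_{[0,t]} cut · G)| ≤ δ`. [folklore] -/
theorem stub_bf18ShellTime : ∀ (G e : ℝ → ℝ) (X0 δ t τ₀ Δ : ℝ), 0 < Δ → 0 ≤ τ₀ → τ₀ + Δ ≤ t →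
    IntegrableOn G (Set.Icc 0 t) → IntegrableOn e (Set.Icc 0 t) → (∀ τ ∈ Set.Icc 0 t, |e τ| ≤ δ) →
    |(∫ τ in Set.Icc 0 t, -deriv (fun s' => Real.smoothTransition ((τ₀ + Δ - s') / Δ)) τ *
        (X0 + (∫ s in Set.Icc 0 τ, G s) + e τ)) -
      (X0 + ∫ s in Set.Icc 0 t, Real.smoothTransition ((τ₀ + Δ - s) / Δ) * G s)| ≤ δ :=
  fun _G _e _X0 _δ _t τ₀ Δ hΔ hτ₀ ht hG he hδ =>
    abs_integral_neg_mul_affine_sub_le (hasDerivAt_cut_deriv τ₀ Δ) (continuous_deriv_cut τ₀ Δ)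
      (weight_nonneg hΔ τ₀) (by linarith) (cut_eq_one hΔ hτ₀) (cut_eq_zero hΔ ht) hG he hδ

end Concrete

end Summit.AtomisticToContinuum.HydrodynamicLimit.Theorems.ChaosClosesEulerShellTime

end
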